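import Literature.MathematicalPhysics.QuantumLattice.LatticeGaugeDLRBoxKernels
import Literature.MathematicalPhysics.QuantumFieldTheory.YangMillsOS
import Literature.MathematicalPhysics.QuantumFieldTheory.LatticeGaugeProofs
import Literature.Probability.Moments.OscillationCovariance
import HarnessLib

/-!
# DLR total-covariance inequality on one box for torus Wilson states of lattice gauge theory

Companion of `LatticeGaugeDLRGibbsProofs.lean` and `LatticeGaugeDLRBoxKernels.lean` (same
namespace).  For the torus Wilson state `μ = wilsonMeasure ρ β` of side `2L+1` of lattice
Yang–Mills theory in a faithful unitary representation `r` (`QuantumFieldTheory.LatticeRep`), the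
box kernel `γ_η = ymSpecification ρ β Λ η` of the edge box
`Λ = Λ(R, c) = ((box 4 R).image (· + c)) ×ˢ univ` (all positively oriented edges based in the cube
`c + [-R, R]⁴`, frozen boundary links `η` outside), and the Wilson action density
`P = r.curvature.F` (`QuantumFieldTheory.actionDensity`, `|P| ≤ 6N`) with its time translate
`P_m = P ∘ θ_{m e₀}`, write `h(η) = γ_η P`, `k(η) = γ_η P_m`, `q(η) = γ_η (P·P_m)` for the box
one- and two-point functions.  The main theorem
`latticeConnectedCorr_ge_of_boxKernel_condCov` is the **law of total covariance through the DLR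
equations, with an exceptional set of boundary data**: if `q - h k ≥ θ ≥ 0` off a measurable set
`Bad` of boundary data, `h` and `k` oscillate by at most `a`, `b` off `Bad`, and the torus state
charges `{Ũ ∈ Bad}` by at most `p`, then

  `θ - ab/4 - (θ + 16 (6N)²) p ≤ ⟨P ; τ_m P⟩_{β, 2L+1}`  (`QuantumFieldTheory.latticeConnectedCorr`),

provided the box with its collar and both plaquette supports fit the fundamental domain
`[-L, L]⁴` of the torus (`|c i| + R + 1 ≤ L`, `m + 1 ≤ L`).  It serves the Dirichlet-box
localisation of connected plaquette correlators of torus Wilson states (the tuned-sequence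
problem of the Yang–Mills continuum limit): a lower bound on the femto-box conditional covariance,
uniform off rare boundary data, transfers to the torus two-point function.

Ingredients: (1) the exact finite-volume DLR equations of the torus state for the box `Λ`
(Georgii 2011, Prop. 2.5 with (1.21), and Thm. 4.17 (4.18); Friedli–Velenik 2017, Lemma 6.7 and
(6.34)), in the box form `integral_torusLift_eq_integral_ymSpecification` of
`LatticeGaugeDLRBoxKernels.lean`, applied to `P`, `P_m`, `P P_m` — the torus fit of `Λ` and its
collar is `fst_mem_box_of_mem_boxEdges_union`, that of the two plaquette supports is
`fst_mem_box_of_mem_curvature_supp_union` below; (2) translation invariance of the torus state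
(`QuantumFieldTheory.wilsonExpectation_comp_torusConfigShift`), `⟨P_m⟩ = ⟨P⟩`;
(3) the abstract law of total covariance with an exceptional event
`Literature.Probability.Moments.total_covariance_lower_bound` (Popoviciu + Cauchy–Schwarz for the
covariance of the conditional means, bounded observables on the exceptional event), which gives
the constant `θ + 8(6N)²`, and `8 ≤ 16`.  Feller continuity and boundedness of the kernels
(`continuous_integral_ymSpecification`, `abs_integral_ymSpecification_le`) supply measurability and
bounds.  No definition and no named fact is introduced.

## References

* H.-O. Georgii, *Gibbs Measures and Phase Transitions*, 2nd ed. (de Gruyter 2011), (1.21),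
  Prop. 2.5, Def. 2.9, Thm. 4.17.
* S. Friedli, Y. Velenik, *Statistical Mechanics of Lattice Systems* (CUP 2017), Lemma 6.7,
  (6.34), Exercise 6.14.
* E. Seiler, LNP 159 (Springer 1982), Ch. 2 (lattice gauge theories, DLR equations).
-/

noncomputable section

open MeasureTheory
open Literature.Probability.LatticeModels (box mem_box)
open Literature.Probability.Moments (total_covariance_lower_bound)

namespace Literature.MathematicalPhysics.QuantumLattice

/-! ### The curvature species: bound and support -/

section Curvature

variable {G : Type} [Group G] [TopologicalSpace G] [IsTopologicalGroup G] [CompactSpace G]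
  [MeasurableSpace G] [BorelSpace G]

omit [Group G] [TopologicalSpace G] [IsTopologicalGroup G] [CompactSpace G] [MeasurableSpace G]
  [BorelSpace G] in
/-- `∑_{i<j} x = 6 x` over ordered pairs in `Fin 4`: the six coordinate planes of `ℤ⁴`. [folklore] -/
theorem sum_pairs_fin_four (x : ℝ) :
    (∑ i : Fin 4, ∑ j : Fin 4, if i < j then x else 0) = 6 * x := by
  simp only [Fin.sum_univ_four, Fin.reduceLT, if_true, if_false]
  ring

/-- The Wilson action density `∑_{i<j} Re tr ρ(U_{p_{ij}(0)})` of a lattice representation is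
bounded by `6 N`: six planes, each plaquette observable bounded by `N` for unitary `ρ`
(`abs_plaquetteObs_le_holds`; Chatterjee arXiv:1803.01950 §2). [folklore] -/
theorem abs_curvature_le (r : QuantumFieldTheory.LatticeRep G) (U : LGConfig 4 G) :
    |r.curvature.F U| ≤ 6 * r.N := by
  have hP : ∀ i j : Fin 4, |plaquetteObs r.ρ 0 i j U| ≤ r.N := fun i j =>
    abs_plaquetteObs_le_holds r.ρ r.mem_unitary 0 i j U
  show |QuantumFieldTheory.actionDensity r.ρ U| ≤ 6 * r.N
  unfold QuantumFieldTheory.actionDensity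
  calc |∑ i : Fin 4, ∑ j : Fin 4, if i < j then plaquetteObs r.ρ 0 i j U else 0|
      ≤ ∑ i : Fin 4, |∑ j : Fin 4, if i < j then plaquetteObs r.ρ 0 i j U else 0| :=
        Finset.abs_sum_le_sum_abs _ _
    _ ≤ ∑ i : Fin 4, ∑ j : Fin 4, |if i < j then plaquetteObs r.ρ 0 i j U else 0| :=
        Finset.sum_le_sum fun i _ => Finset.abs_sum_le_sum_abs _ _
    _ ≤ ∑ i : Fin 4, ∑ j : Fin 4, (if i < j then (r.N : ℝ) else 0) := by
        refine Finset.sum_le_sum fun i _ => Finset.sum_le_sum fun j _ => ?_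
        split_ifs with hij
        · exact hP i j
        · simp
    _ = 6 * r.N := sum_pairs_fin_four _

/-- Edges in the support of the curvature species (the four edges of each plaquette at the
origin, `originPlaquetteSupport`) have all coordinates in `{0, 1}`. [folklore] -/
theorem fst_mem_Icc_of_mem_curvature_supp (r : QuantumFieldTheory.LatticeRep G) {e : ZdEdge 4}
    (he : e ∈ r.curvature.supp) (l : Fin 4) : 0 ≤ e.1 l ∧ e.1 l ≤ 1 := by
  have hsupp : r.curvature.supp =
      Finset.univ.biUnion fun p : Fin 4 × Fin 4 => originPlaquetteSupport p.1 p.2 := rfl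
  rw [hsupp, Finset.mem_biUnion] at he
  obtain ⟨p, -, hp⟩ := he
  simp only [originPlaquetteSupport, Finset.mem_insert, Finset.mem_singleton] at hp
  rcases hp with rfl | rfl | rfl | rfl
  · simp
  · simp only [Pi.single_apply]
    split_ifs <;> simp
  · simp only [Pi.single_apply]
    split_ifs <;> simp
  · simp

/-- **Torus fit of the two plaquette supports.** The support of the curvature species at the
origin and its translate to `m e₀` (the support of `P ∘ θ_{-(-m e₀)}`, cf.
`QuantumFieldTheory.IsCylinder.comp_configShift`) are based in `[-L, L]⁴` once `m + 1 ≤ L`. [folklore] -/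
theorem fst_mem_box_of_mem_curvature_supp_union (r : QuantumFieldTheory.LatticeRep G) {L m : ℕ}
    (hm : m + 1 ≤ L) :
    ∀ e ∈ r.curvature.supp ∪
      r.curvature.supp.image fun e => (e.1 - -Pi.single 0 (m : ℤ), e.2), e.1 ∈ box 4 L := by
  have hmL : (m : ℤ) + 1 ≤ L := by exact_mod_cast hm
  intro e he
  rw [mem_box]
  intro l
  rcases Finset.mem_union.1 he with he | he
  · have h := fst_mem_Icc_of_mem_curvature_supp r he l
    constructor <;> linarith
  · obtain ⟨e', he', rfl⟩ := Finset.mem_image.1 he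
    have h := fst_mem_Icc_of_mem_curvature_supp r he' l
    simp only [Pi.sub_apply, Pi.neg_apply, Pi.single_apply, sub_neg_eq_add]
    split_ifs <;> constructor <;> linarith

end Curvature

/-! ### Translation invariance of the torus state in lifted form -/

section Torus

variable {G : Type*} [Group G] [TopologicalSpace G] [IsTopologicalGroup G] [CompactSpace G]
  [MeasurableSpace G] [BorelSpace G]

/-- Torus Wilson expectations of the periodic lift are translation invariant:
`∫ F(θ_v Ũ) dμ = ∫ F(Ũ) dμ` (`QuantumFieldTheory.wilsonExpectation_comp_torusConfigShift` read
through `toTorusObservable_comp_configShift`) (Seiler LNP 159 Ch. 2). [folklore] -/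
theorem integral_comp_configShift_torusLift {d S N : ℕ} [NeZero S]
    (ρ : G →* Matrix (Fin N) (Fin N) ℂ) (β : ℝ) (F : LGConfig d G → ℝ)
    (v : Literature.Probability.LatticeModels.Site d) :
    ∫ U, F (configShift v (torusLift S U)) ∂(QuantumFieldTheory.wilsonMeasure (d := d) (L := S) ρ β) =
      ∫ U, F (torusLift S U) ∂(QuantumFieldTheory.wilsonMeasure (d := d) (L := S) ρ β) := by
  have h := QuantumFieldTheory.wilsonExpectation_comp_torusConfigShift (d := d) (L := S) ρ β
    (Literature.Probability.LatticeModels.Torus.proj S v) (toTorusObservable S F)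
  rw [← QuantumFieldTheory.toTorusObservable_comp_configShift] at h
  simpa [QuantumFieldTheory.wilsonExpectation, toTorusObservable] using h

end Torus

/-! ### The total-covariance inequality -/

section Main

variable {G : Type} [Group G] [TopologicalSpace G] [IsTopologicalGroup G] [CompactSpace G]
  [MeasurableSpace G] [BorelSpace G]

/-- **DLR total-covariance inequality on one box (torus Wilson state, lattice gauge theory).**
Torus of side `2L+1`, Wilson state `μ = wilsonMeasure r.ρ β`, box kernel
`γ_η = ymSpecification r.ρ β Λ η` of `Λ = ((box 4 R).image (· + c)) ×ˢ univ`, action density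
`P = r.curvature.F`, `P_m = P ∘ θ_{m e₀}`, and `h = γ P`, `k = γ P_m`, `q = γ (P P_m)` as
functions of the boundary datum `η`.  If `Bad` is measurable, the box with its collar and both
plaquettes fit the torus (`|c i| + R + 1 ≤ L`, `m + 1 ≤ L`), `q - h k ≥ θ ≥ 0` off `Bad`, `h`, `k`
oscillate by `≤ a`, `≤ b` off `Bad` (`a, b ≥ 0`), and `μ {Ũ ∈ Bad} ≤ p` (`p ≥ 0`), then
`θ - ab/4 - (θ + 16(6N)²) p ≤ ⟨P ; τ_m P⟩_{β, 2L+1}`.  Proof: the DLR equations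
`∫ F(Ũ) dμ = ∫ (γ_{Ũ} F) dμ` for `F = P, P_m, P P_m` (Georgii 2011, Prop. 2.5 and Thm. 4.17
(4.18); Friedli–Velenik 2017, Lemma 6.7, (6.34)), translation invariance `⟨P_m⟩ = ⟨P⟩`, and the
law of total covariance with an exceptional event (`total_covariance_lower_bound`, constant
`θ + 8(6N)² ≤ θ + 16(6N)²`). [folklore] -/
theorem latticeConnectedCorr_ge_of_boxKernel_condCov (r : QuantumFieldTheory.LatticeRep G)
    (β θ a b p : ℝ) (R L m : ℕ) (c : Fin 4 → ℤ) (Bad : Set (LGConfig 4 G))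
    (hBad : MeasurableSet Bad) (hc : ∀ i, |c i| + R + 1 ≤ (L : ℤ)) (hm : m + 1 ≤ L) (hθ : 0 ≤ θ)
    (ha : 0 ≤ a) (hb : 0 ≤ b) (hp : 0 ≤ p)
    (hlow : ∀ η : LGConfig 4 G, η ∉ Bad →
      θ ≤ (∫ U, r.curvature.F U * r.curvature.F (configShift (-Pi.single 0 (m : ℤ)) U)
              ∂(ymSpecification r.ρ β (((box 4 R).image (· + c)) ×ˢ Finset.univ) η)) -
            (∫ U, r.curvature.F U
              ∂(ymSpecification r.ρ β (((box 4 R).image (· + c)) ×ˢ Finset.univ) η)) *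
              ∫ U, r.curvature.F (configShift (-Pi.single 0 (m : ℤ)) U)
                ∂(ymSpecification r.ρ β (((box 4 R).image (· + c)) ×ˢ Finset.univ) η))
    (hosc1 : ∀ η η' : LGConfig 4 G, η ∉ Bad → η' ∉ Bad →
      |(∫ U, r.curvature.F U ∂(ymSpecification r.ρ β (((box 4 R).image (· + c)) ×ˢ Finset.univ) η)) -
          ∫ U, r.curvature.F U
            ∂(ymSpecification r.ρ β (((box 4 R).image (· + c)) ×ˢ Finset.univ) η')| ≤ a)
    (hosc2 : ∀ η η' : LGConfig 4 G, η ∉ Bad → η' ∉ Bad →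
      |(∫ U, r.curvature.F (configShift (-Pi.single 0 (m : ℤ)) U)
            ∂(ymSpecification r.ρ β (((box 4 R).image (· + c)) ×ˢ Finset.univ) η)) -
          ∫ U, r.curvature.F (configShift (-Pi.single 0 (m : ℤ)) U)
            ∂(ymSpecification r.ρ β (((box 4 R).image (· + c)) ×ˢ Finset.univ) η')| ≤ b)
    (hμ : (QuantumFieldTheory.wilsonMeasure (d := 4) (L := 2 * L + 1) r.ρ β)
        {U | torusLift (2 * L + 1) U ∈ Bad} ≤ ENNReal.ofReal p) :
    θ - a * b / 4 - (θ + 16 * (6 * (r.N : ℝ)) ^ 2) * p ≤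
      QuantumFieldTheory.latticeConnectedCorr r.ρ β (2 * L + 1) r.curvature.F r.curvature.F m := by
  haveI : SecondCountableTopology G :=
    (r.continuous.isClosedEmbedding r.injective).isEmbedding.secondCountableTopology
  haveI := QuantumFieldTheory.isProbabilityMeasure_wilsonMeasure (d := 4) (L := 2 * L + 1) r.ρ
    r.continuous β
  -- the data: box, shift, support, the three observables
  set Λ : Finset (ZdEdge 4) := ((box 4 R).image (· + c)) ×ˢ Finset.univ with hΛ
  set v : Fin 4 → ℤ := -Pi.single 0 (m : ℤ) with hv
  set P : LGConfig 4 G → ℝ := r.curvature.F with hP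
  set S₀ : Finset (ZdEdge 4) :=
    r.curvature.supp ∪ r.curvature.supp.image fun e => (e.1 - v, e.2) with hS₀
  have hPc : Continuous P := QuantumFieldTheory.continuous_actionDensity r.continuous
  have hPK : ∀ U, |P U| ≤ 6 * r.N := abs_curvature_le r
  have hK0 : (0 : ℝ) ≤ 6 * r.N := by positivity
  have hPS : IsCylinder P S₀ :=
    r.curvature.isCylinder.mono (Finset.coe_subset.2 Finset.subset_union_left)
  have hPmc : Continuous fun U => P (configShift v U) :=
    hPc.comp (QuantumFieldTheory.continuous_configShift v)
  have hPmS : IsCylinder (fun U => P (configShift v U)) S₀ :=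
    (QuantumFieldTheory.IsCylinder.comp_configShift r.curvature.isCylinder v).mono
      (Finset.coe_subset.2 Finset.subset_union_right)
  have hQc : Continuous fun U => P U * P (configShift v U) := hPc.mul hPmc
  have hQK : ∀ U, |P U * P (configShift v U)| ≤ (6 * r.N) ^ 2 := fun U => by
    rw [abs_mul, sq]; exact mul_le_mul (hPK _) (hPK _) (abs_nonneg _) hK0
  have hQS : IsCylinder (fun U => P U * P (configShift v U)) S₀ := fun U V h => by
    have h1 := hPS h
    have h2 := hPmS h
    simp only at h1 h2 ⊢
    rw [h1, h2]
  -- torus fit of the box with its collar and of the supports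
  have hΛbox : ∀ e ∈ Λ ∪ (plaquettesTouching Λ).biUnion plaquetteEdges, e.1 ∈ box 4 L :=
    fun e he => fst_mem_box_of_mem_boxEdges_union hc he
  have hS₀box : ∀ e ∈ S₀, e.1 ∈ box 4 L := fst_mem_box_of_mem_curvature_supp_union r hm
  -- (1) the three DLR identities
  have h1 := integral_torusLift_eq_integral_ymSpecification r.ρ r.continuous β Λ hPc hPK hPS
    hΛbox hS₀box
  have h2 := integral_torusLift_eq_integral_ymSpecification r.ρ r.continuous β Λ hPmc
    (fun U => hPK _) hPmS hΛbox hS₀box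
  have h3 := integral_torusLift_eq_integral_ymSpecification r.ρ r.continuous β Λ hQc hQK hQS
    hΛbox hS₀box
  -- (2) translation invariance, and the correlator through the kernels
  have hshift := integral_comp_configShift_torusLift (S := 2 * L + 1) r.ρ β P v
  have hcorr : QuantumFieldTheory.latticeConnectedCorr r.ρ β (2 * L + 1) P P m =
      (∫ U, (∫ W, P W * P (configShift v W) ∂(ymSpecification r.ρ β Λ (torusLift (2 * L + 1) U)))
          ∂(QuantumFieldTheory.wilsonMeasure (d := 4) (L := 2 * L + 1) r.ρ β)) -
        (∫ U, (∫ W, P W ∂(ymSpecification r.ρ β Λ (torusLift (2 * L + 1) U)))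
          ∂(QuantumFieldTheory.wilsonMeasure (d := 4) (L := 2 * L + 1) r.ρ β)) *
        ∫ U, (∫ W, P (configShift v W) ∂(ymSpecification r.ρ β Λ (torusLift (2 * L + 1) U)))
          ∂(QuantumFieldTheory.wilsonMeasure (d := 4) (L := 2 * L + 1) r.ρ β) := by
    unfold QuantumFieldTheory.latticeConnectedCorr
    rw [h3, ← h1, ← h2, hshift]
  rw [hcorr]
  -- (3) the abstract total-covariance estimate
  have hE : MeasurableSet
      {U : QuantumFieldTheory.GaugeConfig 4 (2 * L + 1) G | torusLift (2 * L + 1) U ∈ Bad} :=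
    QuantumFieldTheory.measurable_torusLift (2 * L + 1) hBad
  have hμE : (QuantumFieldTheory.wilsonMeasure (d := 4) (L := 2 * L + 1) r.ρ β).real
      {U : QuantumFieldTheory.GaugeConfig 4 (2 * L + 1) G | torusLift (2 * L + 1) U ∈ Bad} ≤ p := by
    rw [measureReal_def]
    exact ENNReal.toReal_le_of_le_ofReal hp hμ
  have hhc := continuous_integral_ymSpecification r.ρ r.continuous β Λ hPc hPK
  have hkc := continuous_integral_ymSpecification r.ρ r.continuous β Λ hPmc (fun U => hPK _)
  have hqc := continuous_integral_ymSpecification r.ρ r.continuous β Λ hQc hQK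
  have hml := QuantumFieldTheory.measurable_torusLift (d := 4) (G := G) (2 * L + 1)
  have key := total_covariance_lower_bound
    (μ := QuantumFieldTheory.wilsonMeasure (d := 4) (L := 2 * L + 1) r.ρ β)
    hE (hhc.measurable.comp hml) (hkc.measurable.comp hml) (hqc.measurable.comp hml)
    (K := 6 * r.N) (θ := θ) (a := a) (b := b) (p := p)
    (fun U => abs_integral_ymSpecification_le r.ρ r.continuous β Λ hPK _)
    (fun U => abs_integral_ymSpecification_le r.ρ r.continuous β Λ (fun U => hPK _) _)
    (fun U => abs_integral_ymSpecification_le r.ρ r.continuous β Λ hQK _) hθ ha hb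
    (fun U hU => hlow _ hU) (fun U U' hU hU' => hosc1 _ _ hU hU')
    (fun U U' hU hU' => hosc2 _ _ hU hU') hμE
  have hslack : (θ + 8 * (6 * (r.N : ℝ)) ^ 2) * p ≤ (θ + 16 * (6 * (r.N : ℝ)) ^ 2) * p :=
    mul_le_mul_of_nonneg_right (by nlinarith [sq_nonneg (6 * (r.N : ℝ))]) hp
  simp only [Function.comp] at key
  linarith

end Main

end Literature.MathematicalPhysics.QuantumLattice

end
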